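import Summits.ValiantsHypothesis.ValiantsHypothesis.Theorems.KPlusLogSqLawTropicalBSeparatedTowerAll
import Summits.ValiantsHypothesis.ValiantsHypothesis.Theorems.KPlusLogSqLawTropicalBSeparatedTowerGen
import Summits.ValiantsHypothesis.ValiantsHypothesis.Theorems.KPlusLogSqLawTropicalBSeparatedLexRobust

/-!
# Route «KPlusLogSqLaw», crux `TropicalB` (stmt-ValiantsHypothesis-19771) — THE LEXICOGRAPHIC TOWER IS ROBUST: the linear chain bound
# `n ≤ K·m·5^K (+2)` holds for valuations within `B` of the half-exponent lattice (the sector has interior)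

HONEST FRAMING.  Helper toward the registered stubs `stub_tropThin` / `stub_tropFat` of `Cruxes/TropicalB/Lines/birth.lean`
(crux `Summit.ValiantsHypothesis.ValiantsHypothesis.Theses.KPlusLogSqLaw.TropicalB`, item stmt-ValiantsHypothesis-19771, route
KPlusLogSqLaw; cell `pub-symmetroid`, seat val-sym-trop-p1 g8, 2026-08-27; `--supports … --as helper`).  A SECTOR theorem; nothing here
bounds `TropicalB` for general designs or bears on `WeakLifting`, DoorA26 / DoorA34, `MatrixDescartes` or VP ≠ VNP.

THE POINT (seat memo SEPARATED-LEVELS-g8.md §5 (3)).  The headline of …SeparatedTowerAll (`chain_le_tower_doubled`: half-exponent pure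
lexicographic designs with dense extreme classes have every dominant chain of length `≤ K·m·5^K + 2`) assumed valuations EXACTLY on
the lattice `v a b j = d j · u a b j`.  Here the same bounds are proved for valuations within `B` of it, `|v a b j − d j · u a b j| ≤ B`
(`u` the odd lattice digit, `|u| ≤ A`), with the separation constant `8m²(A+B+1)`: `chain_le_tower_robust` (window form, from the
abstract tower `chain_le_tower_of_levelMin` of …SeparatedTowerGen and the robust bridge `level_min_of_isDominant_robust` of
…SeparatedLexRobust), the saturation lemmas `cls_eq_max_of_ge_robust` / `cls_eq_bot_of_le_robust` outside the window, and
`chain_le_tower_add_two_robust` / `chain_le_tower_doubled_robust` (every chain, every slope).  So the linear law of the separated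
sector holds on an open neighbourhood, in the scale-relative sup norm, of the lattice designs — it is not a measure-zero phenomenon
of exact lexicographic valuations; what it still excludes is COUPLING between scales of comparable size (SHIFT-THREE) and sparse
extreme classes.
-/

set_option linter.dupNamespace false
set_option autoImplicit false

namespace Summit.ValiantsHypothesis.ValiantsHypothesis.Theorems.KPlusLogSqLaw

namespace SeparatedLex

open Summit.ValiantsHypothesis.ValiantsHypothesis.Theorems.MatrixDescartes.Negative
open Finset
open scoped BigOperators
open Literature.Computability.MetaComplexity.PBij

variable {m K : ℕ}

/-- **THE ROBUST TOWER THEOREM (window form): `n ≤ K·m·5^K`.**  As `chain_le_tower` (…SeparatedTower) for valuations within `B`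
of the lattice (`|v a b j − d j · u a b j| ≤ B` for `j ≠ z`, separation constant `8m²(A+B+1)`): `chain_le_tower_of_levelMin` with the
robust bridge `level_min_of_isDominant_robust`. -/
theorem chain_le_tower_robust (d : Fin K → ℕ) (v ε : Fin m → Fin m → Fin K → ℤ) (u : Fin m → Fin m → Fin K → ℤ)
    (A B : ℕ) (z : Fin K) (hdz : d z = 0) (hmono : StrictMono d)
    (huR : ∀ a b j, j ≠ z → |v a b j - (d j : ℤ) * u a b j| ≤ B) (huA : ∀ a b j, |u a b j| ≤ A) (hvz : ∀ a b, |v a b z| ≤ A)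
    (hdense : ∀ a b, ε a b z ≠ 0)
    (hsep : ∀ j j', d j < d j' → 8 * m ^ 2 * (A + B + 1) * d j ≤ d j') (hsep0 : ∀ j, j ≠ z → 8 * m ^ 2 * (A + B + 1) ≤ d j)
    (hodd : ∀ a b j, j ≠ z → ε a b j ≠ 0 → Odd (u a b j))
    (hgen : ∀ j, j ≠ z → ∀ X Y : Finset (Fin m × Fin m), IsPMatching X → IsPMatching Y → (∀ e ∈ X, ε e.1 e.2 j ≠ 0) →
      (∀ e ∈ Y, ε e.1 e.2 j ≠ 0) → X.card = Y.card → ∑ e ∈ X, u e.1 e.2 j = ∑ e ∈ Y, u e.1 e.2 j → X = Y)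
    {n : ℕ} (θ : Fin (n + 1) → ℤ) (p : Fin (n + 1) → Equiv.Perm (Fin m) × (Fin m → Fin K))
    (hθ : StrictMono θ) (heven : ∀ k, Even (θ k)) (hwin : ∀ k, |θ k| ≤ (2 * m + 1) * A + 1)
    (hdom : ∀ k, IsDominant d v ε (θ k) (p k)) (hne : ∀ k : Fin n, p k.castSucc ≠ p k.succ) :
    n ≤ K * m * 5 ^ K :=
  chain_le_tower_of_levelMin d v ε u z hdz hmono (fun θ => |θ| ≤ (2 * m + 1) * A + 1)
    (fun l hl _ hw _ hp => level_min_of_isDominant_robust d v ε u A B z l hl hdz hmono.injective huR huA hvz hdense hsep hsep0 hw hp)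
    hodd hgen θ p hθ heven hwin hdom hne

/-- **SATURATION ABOVE THE WINDOW, ROBUST DESIGNS.**  As `cls_eq_max_of_ge` (…SeparatedTowerAll) for valuations within `B` of the
lattice: with a dense top class `t`, a term dominant at a slope `θ ≥ (2m+1)A + 1` has every column in the class `t`. -/
theorem cls_eq_max_of_ge_robust (d : Fin K → ℕ) (v ε : Fin m → Fin m → Fin K → ℤ) (u : Fin m → Fin m → Fin K → ℤ)
    (A B : ℕ) (z t : Fin K) (htz : t ≠ z) (hdz : d z = 0) (hinj : Function.Injective d) (htop : ∀ j, d j ≤ d t)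
    (huR : ∀ a b j, j ≠ z → |v a b j - (d j : ℤ) * u a b j| ≤ B) (huA : ∀ a b j, |u a b j| ≤ A) (hvz : ∀ a b, |v a b z| ≤ A)
    (hdenset : ∀ a b, ε a b t ≠ 0)
    (hsep : ∀ j j', d j < d j' → 8 * m ^ 2 * (A + B + 1) * d j ≤ d j') (hsep0 : ∀ j, j ≠ z → 8 * m ^ 2 * (A + B + 1) ≤ d j)
    {θ : ℤ} (hθ : (2 * m + 1) * A + 1 ≤ θ) {p : Equiv.Perm (Fin m) × (Fin m → Fin K)} (hp : IsDominant d v ε θ p) :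
    ∀ b, p.2 b = t := by
  intro b
  by_contra hb
  have hm1 : (1 : ℤ) ≤ m := by
    have : 0 < m := Fin.pos b
    exact_mod_cast this
  have hA : (0 : ℤ) ≤ A := by positivity
  have hB : (0 : ℤ) ≤ B := by positivity
  have hdt : (8 * (m : ℤ) ^ 2 * (A + B + 1)) ≤ d t := by exact_mod_cast hsep0 t htz
  have hm2 : (1 : ℤ) ≤ (m : ℤ) ^ 2 := by nlinarith [hm1]
  have hdtB : 8 * ((A : ℤ) + B + 1) ≤ d t := by
    have : 8 * ((A : ℤ) + B + 1) * 1 ≤ 8 * ((A : ℤ) + B + 1) * (m : ℤ) ^ 2 := mul_le_mul_of_nonneg_left hm2 (by positivity)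
    linarith
  set q : Equiv.Perm (Fin m) × (Fin m → Fin K) := (p.1, Function.update p.2 b t) with hq
  have hpres := (termSign_ne_zero_iff ε p).1 hp.1
  have hq_pres : termSign ε q ≠ 0 := by
    rw [termSign_ne_zero_iff]; intro b'
    by_cases hb' : b' = b
    · subst hb'; simp only [q, Function.update_self]; exact hdenset _ _
    · simp only [q, Function.update_of_ne hb']; exact hpres b'
  have hq_ne : q ≠ p := by
    intro hqp
    have : q.2 b = p.2 b := by rw [hqp]
    simp only [q, Function.update_self] at this
    exact hb this.symm
  have hdom := hp.2 q hq_ne hq_pres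
  have hdiff := tropWeight_update d v θ p b t
  have hut := huA (p.1 b) b t; rw [abs_le] at hut
  have hvt := huR (p.1 b) b t htz; rw [abs_le] at hvt
  have hq1 : tropWeight d v θ q = tropWeight d v θ (p.1, Function.update p.2 b t) := rfl
  rw [hq1] at hdom
  by_cases hz : p.2 b = z
  · rw [hz, hdz] at hdiff; push_cast at hdiff
    have hv := hvz (p.1 b) b; rw [abs_le] at hv
    have h1 : ((2 * m + 1) * A + 1) * (d t : ℤ) ≤ θ * (d t : ℤ) := mul_le_mul_of_nonneg_right hθ (by positivity)
    have h2 : (d t : ℤ) * u (p.1 b) b t ≤ (d t : ℤ) * A := mul_le_mul_of_nonneg_left hut.2 (by positivity)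
    have h3 : (0 : ℤ) ≤ (m : ℤ) * A * (d t : ℤ) := by positivity
    have h4 : (1 : ℤ) ≤ (m : ℤ) ^ 2 := by nlinarith [hm1]
    have h5 : (A : ℤ) ≤ (m : ℤ) ^ 2 * A := le_mul_of_one_le_left hA h4
    linarith [h1, h2, h3, h5, hv.1, hdom, hdiff, hdt, hm1, hA, hvt.1, hvt.2, hdtB, hB]
  · -- a genuinely lower class `j`
    have hlt : d (p.2 b) < d t := lt_of_le_of_ne (htop _) (fun h => hb (hinj h))
    have hvj := huR (p.1 b) b (p.2 b) hz; rw [abs_le] at hvj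
    have huj := huA (p.1 b) b (p.2 b); rw [abs_le] at huj
    have hsw : 8 * (m : ℤ) ^ 2 * (A + B + 1) * (d (p.2 b) : ℤ) ≤ d t := by exact_mod_cast hsep _ _ hlt
    have hdj8 : 8 * (m : ℤ) ^ 2 * (A + B + 1) ≤ d (p.2 b) := by exact_mod_cast hsep0 _ hz
    have hdjB : 8 * ((A : ℤ) + B + 1) ≤ d (p.2 b) := by
      have : 8 * ((A : ℤ) + B + 1) * 1 ≤ 8 * ((A : ℤ) + B + 1) * (m : ℤ) ^ 2 := mul_le_mul_of_nonneg_left hm2 (by positivity)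
      linarith
    have hdw : (0 : ℤ) ≤ d (p.2 b) := by positivity
    have h0 : (d (p.2 b) : ℤ) < d t := by exact_mod_cast hlt
    have h1 : ((2 * m + 1) * A + 1) * ((d t : ℤ) - d (p.2 b)) ≤ θ * ((d t : ℤ) - d (p.2 b)) :=
      mul_le_mul_of_nonneg_right hθ (by linarith)
    have h2 : (d t : ℤ) * u (p.1 b) b t ≤ (d t : ℤ) * A := mul_le_mul_of_nonneg_left hut.2 (by positivity)
    have h3 : (d (p.2 b) : ℤ) * (-(A : ℤ)) ≤ (d (p.2 b) : ℤ) * u (p.1 b) b (p.2 b) := mul_le_mul_of_nonneg_left huj.1 hdw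
    have hone : (1 : ℤ) ≤ (m : ℤ) ^ 2 * (A + B + 1) := by nlinarith [hm1, hA, hB]
    have h5 : 8 * (d (p.2 b) : ℤ) ≤ d t := by
      have := mul_le_mul_of_nonneg_right hone hdw
      linarith
    have hmA : (0 : ℤ) ≤ (m : ℤ) * A := by positivity
    have h7 : (m : ℤ) * A * (8 * (d (p.2 b) : ℤ)) ≤ (m : ℤ) * A * (d t : ℤ) := mul_le_mul_of_nonneg_left h5 hmA
    have h8 : 1 * ((A : ℤ) * (d (p.2 b) : ℤ)) ≤ (m : ℤ) * ((A : ℤ) * (d (p.2 b) : ℤ)) := mul_le_mul_of_nonneg_right hm1 (by positivity)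
    have h6 : (0 : ℤ) ≤ (m : ℤ) * A * (d (p.2 b) : ℤ) := by positivity
    linarith [h0, h1, h2, h3, h7, h8, h6, hdom, hdiff, hvt.1, hvt.2, hvj.1, hvj.2, hdjB, hB]

/-- **SATURATION BELOW THE WINDOW, ROBUST DESIGNS.**  As `cls_eq_bot_of_le` (…SeparatedThreeAll) for valuations within `B` of the
lattice: a term dominant at a slope `θ ≤ −((2m+1)A + 1)` has every column in the dense bottom class `z`. -/
theorem cls_eq_bot_of_le_robust (d : Fin K → ℕ) (v ε : Fin m → Fin m → Fin K → ℤ) (u : Fin m → Fin m → Fin K → ℤ)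
    (A B : ℕ) (z : Fin K) (hdz : d z = 0)
    (huR : ∀ a b j, j ≠ z → |v a b j - (d j : ℤ) * u a b j| ≤ B) (huA : ∀ a b j, |u a b j| ≤ A) (hvz : ∀ a b, |v a b z| ≤ A)
    (hdense : ∀ a b, ε a b z ≠ 0) (hsep0 : ∀ j, j ≠ z → 8 * m ^ 2 * (A + B + 1) ≤ d j)
    {θ : ℤ} (hθ : θ ≤ -((2 * m + 1) * A + 1)) {p : Equiv.Perm (Fin m) × (Fin m → Fin K)} (hp : IsDominant d v ε θ p) :
    ∀ b, p.2 b = z := by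
  intro b
  by_contra hb
  have hm1 : (1 : ℤ) ≤ m := by
    have : 0 < m := Fin.pos b
    exact_mod_cast this
  have hA : (0 : ℤ) ≤ A := by positivity
  set q : Equiv.Perm (Fin m) × (Fin m → Fin K) := (p.1, Function.update p.2 b z) with hq
  have hpres := (termSign_ne_zero_iff ε p).1 hp.1
  have hq_pres : termSign ε q ≠ 0 := by
    rw [termSign_ne_zero_iff]; intro b'
    by_cases hb' : b' = b
    · subst hb'; simp only [q, Function.update_self]; exact hdense _ _
    · simp only [q, Function.update_of_ne hb']; exact hpres b'
  have hq_ne : q ≠ p := by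
    intro hqp
    have : q.2 b = p.2 b := by rw [hqp]
    simp only [q, Function.update_self] at this
    exact hb this.symm
  have hdom := hp.2 q hq_ne hq_pres
  have hdiff := tropWeight_update d v θ p b z
  rw [hdz] at hdiff; push_cast at hdiff
  have hB : (0 : ℤ) ≤ B := by positivity
  have hvj := huR (p.1 b) b (p.2 b) hb; rw [abs_le] at hvj
  have hv := hvz (p.1 b) b; rw [abs_le] at hv
  have huj := huA (p.1 b) b (p.2 b); rw [abs_le] at huj
  have hdj : 8 * (m : ℤ) ^ 2 * (A + B + 1) ≤ d (p.2 b) := by exact_mod_cast hsep0 _ hb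
  have hm2 : (1 : ℤ) ≤ (m : ℤ) ^ 2 := by nlinarith [hm1]
  have hdjB : 8 * ((A : ℤ) + B + 1) ≤ d (p.2 b) := by
    have : 8 * ((A : ℤ) + B + 1) * 1 ≤ 8 * ((A : ℤ) + B + 1) * (m : ℤ) ^ 2 := mul_le_mul_of_nonneg_left hm2 (by positivity)
    linarith
  have hdj0 : (0 : ℤ) ≤ d (p.2 b) := by positivity
  -- W q − W p = −v_z − θ d_j + d_j u_j ≥ −A + Θ d_j − d_j A > 0
  have h1 : ((2 * m + 1) * A + 1) * (d (p.2 b) : ℤ) ≤ -θ * (d (p.2 b) : ℤ) := mul_le_mul_of_nonneg_right (by linarith) hdj0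
  have h2 : (d (p.2 b) : ℤ) * (-(A : ℤ)) ≤ (d (p.2 b) : ℤ) * u (p.1 b) b (p.2 b) := mul_le_mul_of_nonneg_left huj.1 hdj0
  have h3 : (0 : ℤ) ≤ (m : ℤ) * A * (d (p.2 b) : ℤ) := by positivity
  have h4 : (1 : ℤ) ≤ (m : ℤ) ^ 2 := hm2
  have h5 : (A : ℤ) ≤ (m : ℤ) ^ 2 * A := le_mul_of_one_le_left hA h4
  have hq1 : tropWeight d v θ q = tropWeight d v θ (p.1, Function.update p.2 b z) := rfl
  rw [hq1] at hdom
  linarith [h1, h2, h3, h5, hv.2, hdom, hdiff, hdj, hm1, hA, hvj.1, hvj.2, hdjB, hB]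

/-- **THE ROBUST TOWER BOUND FOR EVERY CHAIN AT EVEN SLOPES: `n ≤ K·m·5^K + 2`.**  As `chain_le_tower_add_two` (…SeparatedTowerAll) for
valuations within `B` of the lattice (separation constant `8m²(A+B+1)`). -/
theorem chain_le_tower_add_two_robust (d : Fin K → ℕ) (v ε : Fin m → Fin m → Fin K → ℤ) (u : Fin m → Fin m → Fin K → ℤ)
    (A B : ℕ) (z t : Fin K) (htz : t ≠ z) (hdz : d z = 0) (hmono : StrictMono d) (htop : ∀ j, d j ≤ d t)
    (huR : ∀ a b j, j ≠ z → |v a b j - (d j : ℤ) * u a b j| ≤ B) (huA : ∀ a b j, |u a b j| ≤ A) (hvz : ∀ a b, |v a b z| ≤ A)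
    (hdense : ∀ a b, ε a b z ≠ 0) (hdenset : ∀ a b, ε a b t ≠ 0)
    (hsep : ∀ j j', d j < d j' → 8 * m ^ 2 * (A + B + 1) * d j ≤ d j') (hsep0 : ∀ j, j ≠ z → 8 * m ^ 2 * (A + B + 1) ≤ d j)
    (hodd : ∀ a b j, j ≠ z → ε a b j ≠ 0 → Odd (u a b j))
    (hgen : ∀ j, j ≠ z → ∀ X Y : Finset (Fin m × Fin m), IsPMatching X → IsPMatching Y → (∀ e ∈ X, ε e.1 e.2 j ≠ 0) →
      (∀ e ∈ Y, ε e.1 e.2 j ≠ 0) → X.card = Y.card → ∑ e ∈ X, u e.1 e.2 j = ∑ e ∈ Y, u e.1 e.2 j → X = Y)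
    {n : ℕ} (θ : Fin (n + 1) → ℤ) (p : Fin (n + 1) → Equiv.Perm (Fin m) × (Fin m → Fin K))
    (hθ : StrictMono θ) (heven : ∀ k, Even (θ k)) (hdom : ∀ k, IsDominant d v ε (θ k) (p k))
    (hne : ∀ k : Fin n, p k.castSucc ≠ p k.succ) :
    n ≤ K * m * 5 ^ K + 2 := by
  have hinj : Function.Injective d := hmono.injective
  have htop' : ∀ k : Fin (n + 1), (2 * (m : ℤ) + 1) * A + 1 < θ k → (k : ℕ) = n := by
    intro k hk
    by_contra hkn
    have hk' : (k : ℕ) < n := lt_of_le_of_ne (Nat.lt_succ_iff.1 k.2) hkn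
    set k₀ : Fin n := ⟨k, hk'⟩ with hk₀
    have e0 : k₀.castSucc = k := Fin.ext rfl
    have hlt : θ k₀.castSucc < θ k₀.succ := hθ Fin.castSucc_lt_succ
    rw [e0] at hlt
    have h1 := cls_eq_max_of_ge_robust d v ε u A B z t htz hdz hinj htop huR huA hvz hdenset hsep hsep0 hk.le (hdom k)
    have h2 := cls_eq_max_of_ge_robust d v ε u A B z t htz hdz hinj htop huR huA hvz hdenset hsep hsep0 (by linarith) (hdom k₀.succ)
    refine not_dominant_of_cls_eq d v ε (hdom k₀.castSucc) (hdom k₀.succ) (hne k₀) ?_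
    funext b; rw [e0, h1 b, h2 b]
  have hbot : ∀ k : Fin (n + 1), θ k < -((2 * (m : ℤ) + 1) * A + 1) → (k : ℕ) = 0 := by
    intro k hk
    by_contra hk0
    have hk' : 0 < (k : ℕ) := Nat.pos_of_ne_zero hk0
    set k₀ : Fin n := ⟨k - 1, by omega⟩ with hk₀
    have e0 : k₀.succ = k := Fin.ext (by simp [hk₀]; omega)
    have hlt : θ k₀.castSucc < θ k₀.succ := hθ Fin.castSucc_lt_succ
    rw [e0] at hlt
    have h1 := cls_eq_bot_of_le_robust d v ε u A B z hdz huR huA hvz hdense hsep0 hk.le (hdom k)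
    have h2 := cls_eq_bot_of_le_robust d v ε u A B z hdz huR huA hvz hdense hsep0 (by linarith) (hdom k₀.castSucc)
    refine not_dominant_of_cls_eq d v ε (hdom k₀.castSucc) (hdom k₀.succ) (hne k₀) ?_
    funext b; rw [e0, h1 b, h2 b]
  rcases Nat.lt_or_ge n 2 with hn | hn
  · omega
  let a : ℕ := if θ ⟨0, by omega⟩ < -((2 * (m : ℤ) + 1) * A + 1) then 1 else 0
  let c : ℕ := if (2 * (m : ℤ) + 1) * A + 1 < θ ⟨n, by omega⟩ then 1 else 0
  have ha : a ≤ 1 := by simp only [a]; split_ifs <;> omega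
  have hc : c ≤ 1 := by simp only [c]; split_ifs <;> omega
  have hwin : ∀ j : ℕ, a ≤ j → j + c ≤ n → ∀ hj : j < n + 1, |θ ⟨j, hj⟩| ≤ (2 * (m : ℤ) + 1) * A + 1 := by
    intro j haj hjc hj
    rw [abs_le]
    constructor
    · by_contra hlt
      rw [not_le] at hlt
      have := hbot ⟨j, hj⟩ hlt
      simp only at this
      subst this
      have : a = 1 := by simp only [a]; rw [if_pos hlt]
      omega
    · by_contra hlt
      rw [not_le] at hlt
      have := htop' ⟨j, hj⟩ hlt
      simp only at this
      subst this
      have : c = 1 := by simp only [c]; rw [if_pos hlt]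
      omega
  set n' : ℕ := n - a - c with hn'
  let θ' : Fin (n' + 1) → ℤ := fun i => θ ⟨i + a, by omega⟩
  let p' : Fin (n' + 1) → Equiv.Perm (Fin m) × (Fin m → Fin K) := fun i => p ⟨i + a, by omega⟩
  have hθ' : StrictMono θ' := by
    intro i j hij
    exact hθ (by simp only [Fin.lt_def]; exact Nat.add_lt_add_right hij a)
  have hdom' : ∀ i, IsDominant d v ε (θ' i) (p' i) := fun i => hdom _
  have heven' : ∀ i, Even (θ' i) := fun i => heven _
  have hne' : ∀ i : Fin n', p' i.castSucc ≠ p' i.succ := by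
    intro i
    have e1 : p' i.castSucc = p (⟨i + a, by omega⟩ : Fin n).castSucc := rfl
    have e2 : p' i.succ = p (⟨i + a, by omega⟩ : Fin n).succ := by
      simp only [p', Fin.succ_mk, Fin.val_succ]
      congr 1; exact Fin.ext (by simp; omega)
    rw [e1, e2]; exact hne _
  have hwin' : ∀ i : Fin (n' + 1), |θ' i| ≤ (2 * (m : ℤ) + 1) * A + 1 := by
    intro i; exact hwin (i + a) (by omega) (by omega) _
  have hmain := chain_le_tower_robust d v ε u A B z hdz hmono huR huA hvz hdense hsep hsep0 hodd hgen θ' p' hθ' heven' hwin' hdom' hne'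
  omega

/-- **THE HALF-EXPONENT SECTOR HAS INTERIOR: LINEAR, EVERY CHAIN, EVERY SLOPE, FOR VALUATIONS NEAR THE LATTICE.**  A design of
format `(m, K)` with EVEN exponents `2·d j` (`d` strictly increasing, `d z = 0`), class valuations within `B` of odd multiples of half the
exponent — `|v a b j − d j · u a b j| ≤ B`, `u a b j` ODD, `|u| ≤ A` for `j ≠ z` —, `|v a b z| ≤ A`, dense bottom AND top classes,
super-separated `d` (constant `8m²(A+B+1)`) and generic digits per class: EVERY chain of distinct consecutive terms dominant at strictly
increasing integer slopes has `n ≤ K·m·5^K + 2`. -/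
theorem chain_le_tower_doubled_robust (d : Fin K → ℕ) (v ε : Fin m → Fin m → Fin K → ℤ) (u : Fin m → Fin m → Fin K → ℤ)
    (A B : ℕ) (z t : Fin K) (htz : t ≠ z) (hdz : d z = 0) (hmono : StrictMono d) (htop : ∀ j, d j ≤ d t)
    (huR : ∀ a b j, j ≠ z → |v a b j - (d j : ℤ) * u a b j| ≤ B) (huA : ∀ a b j, |u a b j| ≤ A) (hvz : ∀ a b, |v a b z| ≤ A)
    (hdense : ∀ a b, ε a b z ≠ 0) (hdenset : ∀ a b, ε a b t ≠ 0)
    (hsep : ∀ j j', d j < d j' → 8 * m ^ 2 * (A + B + 1) * d j ≤ d j') (hsep0 : ∀ j, j ≠ z → 8 * m ^ 2 * (A + B + 1) ≤ d j)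
    (hodd : ∀ a b j, j ≠ z → ε a b j ≠ 0 → Odd (u a b j))
    (hgen : ∀ j, j ≠ z → ∀ X Y : Finset (Fin m × Fin m), IsPMatching X → IsPMatching Y → (∀ e ∈ X, ε e.1 e.2 j ≠ 0) →
      (∀ e ∈ Y, ε e.1 e.2 j ≠ 0) → X.card = Y.card → ∑ e ∈ X, u e.1 e.2 j = ∑ e ∈ Y, u e.1 e.2 j → X = Y)
    {n : ℕ} (θ : Fin (n + 1) → ℤ) (p : Fin (n + 1) → Equiv.Perm (Fin m) × (Fin m → Fin K))
    (hθ : StrictMono θ) (hdom : ∀ k, IsDominant (fun j => 2 * d j) v ε (θ k) (p k))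
    (hne : ∀ k : Fin n, p k.castSucc ≠ p k.succ) :
    n ≤ K * m * 5 ^ K + 2 := by
  refine chain_le_tower_add_two_robust d v ε u A B z t htz hdz hmono htop huR huA hvz hdense hdenset hsep hsep0 hodd hgen
    (fun k => 2 * θ k) p (fun i j hij => by have := hθ hij; simp only; linarith) (fun k => ⟨θ k, two_mul _⟩)
    (fun k => (isDominant_two_mul_iff d v ε (θ k) (p k)).1 (hdom k)) hne

end SeparatedLex

end Summit.ValiantsHypothesis.ValiantsHypothesis.Theorems.KPlusLogSqLaw
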